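import Literature.MathematicalPhysics.QuantumLattice.HubbardLiebBasis
import Literature.MathematicalPhysics.QuantumLattice.HubbardOddSectorReduction
import Mathlib.Analysis.Matrix.Order
import HarnessLib

/-!
# The charge gap dominates the spin gap in the half-filled Hubbard model (Tian 1998)

Topic `MathematicalPhysics/QuantumLattice` (family `hubbard`). G.-S. Tian, *Charged gap and spin
excitation gap: relations between them in some strongly correlated electron models at
half-filling*, Phys. Rev. B **58** (1998) 7612 (arXiv:cond-mat/9807272), **Theorem** (Hubbard
part): for the half-filled Hubbard model on a bipartite lattice with `|A| = |B|` and `U > 0` the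
charged gap `Δ_c = E₀(N+1) + E₀(N-1) - 2E₀(N)` is not smaller than the spin excitation gap.

Everything here is PROVED for the concrete Jordan–Wigner model `hamiltonian G t U` of
`HubbardWave0` (`H = -t Σ c†c + U Σ n↑n↓`), in the tree's vocabulary: the spin gap is
`(hamiltonian G t U).minEnergyOn (szSector |Λ| 1) - groundEnergyAt G t U |Λ|` (the lowest energy
with `S^z = 1` at half filling minus the ground-state energy, as in
`groundEnergyAt_lt_minEnergyOn_szSector_one` of `HubbardHalfFilledGroundState`) and the charge gap
is `chargeGap G t U |Λ|` of `HubbardModel`.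

## The printed proof and how it is followed

Tian's Steps 1–2 (partial particle–hole transformation on the down spins, `U ↦ -U`, and Lieb's
two-species coordinates `Ψ = Σ W_{mn} χ_m^↑ ⊗ χ_n^↓`) are the tree's `LiebTwo.toFock` /
`LiebTwo.hamiltonian_mulVec_toFock` (`HubbardLiebBasis`): on coefficient matrices
`M : Matrix (Finset Λ) (Finset Λ) ℂ` (rows = up configurations, columns = down HOLE
configurations) the repulsive Hamiltonian acts as `𝓛₀ M + U N M` with
`𝓛₀ = liebOp K n (-U)` Lieb's ATTRACTIVE operator (`LiebSpinReflection`), and a vector of the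
sector `(N↑, N↓) = (a, |Λ| - b)` is a matrix supported on `a`-particle rows and `b`-particle
columns — rectangular when `a ≠ b`, which is Tian's "nuisance" (Step 3).

Step 3 (Tian's polar-factorisation Lemma `𝒲 = U H V` for the zero-padded square matrix and the
Cauchy–Schwarz bound (Bound1) ⇒ (Bound2) `E₀(Ñ+1) ≥ ½ E₀(Ñ+2) + ½ E₀(Ñ)`) is carried out here with
the Hermitian dilation `X = M + Mᴴ` instead of the polar factorisation (Mathlib has no SVD; the
tree has Lieb's trace inequality `re_trace_unitConj_mul_le` for HERMITIAN matrices): `X` is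
Hermitian, `E(X) = 2 E(M)`, Lieb's `|X|` satisfies `E(|X|) ≤ E(X)` and `‖|X|‖ = ‖X‖`
(`exists_abs_energy_le`), and `|X|` is block diagonal for the particle-number grading — the blocks
`Π_a |X| Π_a`, `Π_b |X| Π_b` are Tian's `Ψ₁ ∈ V(a, a)` and `Ψ₂ ∈ V(b, b)`, each of norm `‖M‖`
(`abs_dilation_decomp`; block diagonality is the uniqueness of the positive square root applied to
`Γ |X| Γ`, `Γ = 1 - 2Π_a`, `Γ X Γ = -X`). The variational principle in the two square sectors
gives the sector inequality `minEnergyOn_upDown_reflection_ineq`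
(`E(a, |Λ|-a) + E(b, |Λ|-b) + U (a - b) ≤ 2 E(a, |Λ|-b)`, the `U (a - b)` coming from the one-body
term `U N_↑` of the transformation in the tree's convention `U n↑ n↓`).

Step 4 (transforming back; Tian's (Bound3)–(Bound4)) is here free of particle–hole symmetry: at
`|Λ| = 2n` the two instances `(a, b) = (n + 1, n)` and `(n, n + 1)` read
`E(2n, S^z=1) + E₀(2n) + U ≤ 2 E₀(2n + 1)` and `E(2n, S^z=1) + E₀(2n) - U ≤ 2 E₀(2n - 1)`
(`…_add_le_two_mul_groundEnergyAt_succ` / `…_sub_le_two_mul_groundEnergyAt_pred`, using the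
tree's reductions `groundEnergyAt_eq_minEnergyOn_szSector(_odd)` of the ground-state energy to the
sectors `S^z = 0`, `S^z = ½`), and their mean is the theorem
`minEnergyOn_szSector_one_sub_groundEnergyAt_le_chargeGap`:
`E(|Λ|, S^z = 1) - E₀(|Λ|) ≤ Δ_c(|Λ|)`. As printed, only bipartiteness, `|A| = |B|` and `U ≥ 0`
are used (no connectivity, any real `t`); the strict inequality of Tian's Remark 4 is not
formalised.

No definitions and no named facts: theorems only.

## References

* G.-S. Tian, Phys. Rev. B 58 (1998) 7612–7618, Theorem and Steps 1–4 of its proof,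
  eqs. (Bound1)–(Bound4). [Tian1998ChargeSpinGap] (arXiv:cond-mat/9807272, pp. 5–9 read.)
* G.-S. Tian, J. Phys. A 30 (1997) 5329 (the polar-factorisation lemma, Appendix). [cite only]
* E. H. Lieb, Phys. Rev. Lett. 62 (1989) 1201, proof of Theorems 1–2 (spin-reflection
  positivity; the tree files `LiebSpinReflection`, `HubbardLiebBasis`). [LiebPRL1989]
-/

noncomputable section

namespace Literature.MathematicalPhysics.QuantumLattice

open Matrix Finset
open scoped ComplexOrder

section ChargeGapSpinGap

variable {Λ : Type*} [LinearOrder Λ] [Fintype Λ]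

/-! ### The particle-number grading of the spinless configuration space -/

/- Throughout, `Π_a = diagonal (fun α : Finset Λ => if α.card = a then (1 : ℂ) else 0)` denotes the
orthogonal projection of `ℓ²(Finset Λ)` onto the `a`-particle configurations (always written out;
no definition or notation is introduced). -/

/-- `Π_a` acts on the left by restricting the rows to particle number `a`. [folklore] -/
private theorem cardProj_mul_apply (a : ℕ) (M : Matrix (Finset Λ) (Finset Λ) ℂ) (α β : Finset Λ) :
    ((diagonal fun γ : Finset Λ => if γ.card = a then (1 : ℂ) else 0) * M) α β =
      if α.card = a then M α β else 0 := by
  rw [diagonal_mul]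
  split_ifs <;> simp

/-- `Π_a` acts on the right by restricting the columns to particle number `a`. [folklore] -/
private theorem mul_cardProj_apply (a : ℕ) (M : Matrix (Finset Λ) (Finset Λ) ℂ) (α β : Finset Λ) :
    (M * (diagonal fun γ : Finset Λ => if γ.card = a then (1 : ℂ) else 0)) α β =
      if β.card = a then M α β else 0 := by
  rw [mul_diagonal]
  split_ifs <;> simp

omit [Fintype Λ] in
/-- `Π_a` is Hermitian. [folklore] -/
private theorem cardProj_conjTranspose (a : ℕ) :
    (diagonal fun α : Finset Λ => if α.card = a then (1 : ℂ) else 0)ᴴ =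
      (diagonal fun α : Finset Λ => if α.card = a then (1 : ℂ) else 0) := by
  rw [diagonal_conjTranspose]
  congr 1
  funext α
  simp only [Pi.star_apply]
  split_ifs <;> simp

/-- `Π_a` is idempotent. [folklore] -/
private theorem cardProj_mul_cardProj (a : ℕ) :
    (diagonal fun α : Finset Λ => if α.card = a then (1 : ℂ) else 0) *
        (diagonal fun α : Finset Λ => if α.card = a then (1 : ℂ) else 0) =
      (diagonal fun α : Finset Λ => if α.card = a then (1 : ℂ) else 0) := by
  rw [diagonal_mul_diagonal]
  congr 1
  funext α
  split_ifs <;> simp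

/-- A matrix with `a`-particle rows is fixed by `Π_a` on the left. [folklore] -/
private theorem cardProj_mul_of_row {a : ℕ} {M : Matrix (Finset Λ) (Finset Λ) ℂ}
    (hM : ∀ α β, M α β ≠ 0 → α.card = a) :
    (diagonal fun α : Finset Λ => if α.card = a then (1 : ℂ) else 0) * M = M := by
  ext α β
  rw [cardProj_mul_apply]
  by_cases h0 : M α β = 0
  · rw [h0]; split_ifs <;> rfl
  · rw [if_pos (hM α β h0)]

/-- A matrix with `a`-particle rows is killed by `Π_c`, `c ≠ a`, on the left. [folklore] -/
private theorem cardProj_mul_eq_zero_of_row {a c : ℕ} (hca : c ≠ a)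
    {M : Matrix (Finset Λ) (Finset Λ) ℂ} (hM : ∀ α β, M α β ≠ 0 → α.card = a) :
    (diagonal fun α : Finset Λ => if α.card = c then (1 : ℂ) else 0) * M = 0 := by
  ext α β
  rw [cardProj_mul_apply, Matrix.zero_apply]
  by_cases h0 : M α β = 0
  · rw [h0]; split_ifs <;> rfl
  · rw [if_neg]
    exact fun h => hca (h.symm.trans (hM α β h0))

/-- A matrix with `b`-particle columns is fixed by `Π_b` on the right. [folklore] -/
private theorem mul_cardProj_of_col {b : ℕ} {M : Matrix (Finset Λ) (Finset Λ) ℂ}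
    (hM : ∀ α β, M α β ≠ 0 → β.card = b) :
    M * (diagonal fun α : Finset Λ => if α.card = b then (1 : ℂ) else 0) = M := by
  ext α β
  rw [mul_cardProj_apply]
  by_cases h0 : M α β = 0
  · rw [h0]; split_ifs <;> rfl
  · rw [if_pos (hM α β h0)]

/-- A matrix with `b`-particle columns is killed by `Π_c`, `c ≠ b`, on the right. [folklore] -/
private theorem mul_cardProj_eq_zero_of_col {b c : ℕ} (hcb : c ≠ b)
    {M : Matrix (Finset Λ) (Finset Λ) ℂ} (hM : ∀ α β, M α β ≠ 0 → β.card = b) :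
    M * (diagonal fun α : Finset Λ => if α.card = c then (1 : ℂ) else 0) = 0 := by
  ext α β
  rw [mul_cardProj_apply, Matrix.zero_apply]
  by_cases h0 : M α β = 0
  · rw [h0]; split_ifs <;> rfl
  · rw [if_neg]
    exact fun h => hcb (h.symm.trans (hM α β h0))

omit [LinearOrder Λ] [Fintype Λ] in
/-- The adjoint of a matrix supported on `(a, b)` is supported on `(b, a)`. [folklore] -/
private theorem supp_conjTranspose {a b : ℕ} {M : Matrix (Finset Λ) (Finset Λ) ℂ}
    (hM : ∀ α β, M α β ≠ 0 → α.card = a ∧ β.card = b) :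
    ∀ α β, Mᴴ α β ≠ 0 → α.card = b ∧ β.card = a := by
  intro α β h
  rw [conjTranspose_apply, star_ne_zero] at h
  exact (hM β α h).symm

/-- `Π_c Z Π_d` is supported on `(c, d)`. [folklore] -/
private theorem supp_cardProj_mul_mul_cardProj (c d : ℕ) (Z : Matrix (Finset Λ) (Finset Λ) ℂ) :
    ∀ α β : Finset Λ,
      ((diagonal fun γ : Finset Λ => if γ.card = c then (1 : ℂ) else 0) * Z *
          (diagonal fun γ : Finset Λ => if γ.card = d then (1 : ℂ) else 0) :
          Matrix (Finset Λ) (Finset Λ) ℂ) α β ≠ 0 →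
        α.card = c ∧ β.card = d := by
  intro α β h
  rw [mul_cardProj_apply] at h
  by_cases hβ : β.card = d
  · rw [if_pos hβ, cardProj_mul_apply] at h
    by_cases hα : α.card = c
    · exact ⟨hα, hβ⟩
    · rw [if_neg hα] at h
      exact absurd rfl h
  · rw [if_neg hβ] at h
    exact absurd rfl h

omit [LinearOrder Λ] in
/-- Matrices with rows of different particle numbers are Hilbert–Schmidt orthogonal. [folklore] -/
private theorem hsInner_eq_zero_of_row {a₁ a₂ : ℕ} (h : a₁ ≠ a₂)
    {M₁ M₂ : Matrix (Finset Λ) (Finset Λ) ℂ}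
    (h₁ : ∀ α β, M₁ α β ≠ 0 → α.card = a₁) (h₂ : ∀ α β, M₂ α β ≠ 0 → α.card = a₂) :
    hsInner M₁ M₂ = 0 := by
  rw [hsInner_apply]
  refine Finset.sum_eq_zero fun α _ => Finset.sum_eq_zero fun β _ => ?_
  by_cases hα : M₁ α β = 0
  · rw [hα, star_zero, zero_mul]
  · have h2 : M₂ α β = 0 := by
      by_contra h2
      exact h ((h₁ α β hα).symm.trans (h₂ α β h2))
    rw [h2, mul_zero]

variable (G : SimpleGraph Λ) [DecidableRel G.Adj]

/-- Lieb's attractive operator `𝓛₀ = liebOp K n (-U)` preserves the particle number of the rows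
(`K` preserves the particle number, `n_x` is diagonal). [folklore] -/
private theorem row_liebOp {c : ℕ} (t U : ℝ) {M : Matrix (Finset Λ) (Finset Λ) ℂ}
    (hM : ∀ α β, M α β ≠ 0 → α.card = c) :
    ∀ α β, liebOp (hoppingMatrix G t) numberAt (-U) M α β ≠ 0 → α.card = c := by
  intro α β h
  by_contra hc
  apply h
  have hrow : ∀ γ, M α γ = 0 := fun γ => by_contra fun h' => hc (hM α γ h')
  have h1 : (hoppingMatrix G t * M) α β = 0 := by
    rw [Matrix.mul_apply]
    refine Finset.sum_eq_zero fun γ _ => ?_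
    by_cases hK : hoppingMatrix G t α γ = 0
    · rw [hK, zero_mul]
    · have hγ : M γ β = 0 := by
        by_contra h'
        exact hc ((LiebTwo.hoppingMatrix_apply_ne_zero G hK).trans (hM γ β h'))
      rw [hγ, mul_zero]
  have h2 : (M * hoppingMatrix G t) α β = 0 := by
    rw [Matrix.mul_apply]
    exact Finset.sum_eq_zero fun γ _ => by rw [hrow γ, zero_mul]
  have h3 : ∀ x : Λ, (numberAt x * M * numberAt x) α β = 0 := by
    intro x
    rw [numberAt_eq_diagonal, Matrix.mul_assoc, diagonal_mul, mul_diagonal, hrow β, zero_mul,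
      mul_zero]
  rw [liebOp, Matrix.add_apply, Matrix.add_apply, Matrix.smul_apply, Matrix.sum_apply, h1, h2,
    Finset.sum_eq_zero fun x _ => h3 x, smul_zero, add_zero, add_zero]

/-- `E(Mᴴ) = E(M)` for Lieb's functional `E(M) = ⟨M, 𝓛₀ M⟩` ("the Hamiltonian is symmetric
between the up and the down spins"; `(𝓛₀ M)ᴴ = 𝓛₀ Mᴴ` and `𝓛₀` is Hilbert–Schmidt
self-adjoint). Lieb, PRL 62 (1989) 1201, proof of Theorem 1.
[cite: LiebPRL1989, proof of Theorem 1] -/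
private theorem hsInner_liebOp_conjTranspose_self (t U : ℝ) (M : Matrix (Finset Λ) (Finset Λ) ℂ) :
    hsInner Mᴴ (liebOp (hoppingMatrix G t) numberAt (-U) Mᴴ) =
      hsInner M (liebOp (hoppingMatrix G t) numberAt (-U) M) := by
  have hK : (hoppingMatrix G t)ᴴ = hoppingMatrix G t := hoppingMatrix_conjTranspose t
  have hL : ∀ x : Λ, (numberAt x : Matrix (Finset Λ) (Finset Λ) ℂ)ᴴ = numberAt x :=
    fun x => (numberAt_isHermitian x).eq
  calc hsInner Mᴴ (liebOp (hoppingMatrix G t) numberAt (-U) Mᴴ)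
      = hsInner Mᴴ (liebOp (hoppingMatrix G t) numberAt (-U) M)ᴴ := by
        rw [liebOp_conjTranspose (-U) hK hL]
    _ = hsInner (liebOp (hoppingMatrix G t) numberAt (-U) M) M := by
        simp only [hsInner, conjTranspose_conjTranspose]
        rw [trace_mul_comm]
    _ = hsInner M (liebOp (hoppingMatrix G t) numberAt (-U) M) :=
        (hsInner_liebOp_comm (-U) hK hL M M).symm

/-- **Spin-reflection positivity for the dilation** (Lieb's `|W|`): for a Hermitian `X` and
`U ≥ 0` there is a positive semidefinite `P` (`= |X| = V D_{|x|} Vᴴ`) with `P² = X²`,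
`‖P‖ = ‖X‖` and `E(P) ≤ E(X)` for the attractive functional
`E(Z) = ⟨Z, 𝓛₀ Z⟩ = 2 Tr K Z² - U Σ_x Tr Z n_x Z n_x`. Lieb, PRL 62 (1989) 1201, proof of Theorem 1
(the inequality after eq. (4)); Tian, PRB 58 (1998) 7612, Step 3, (Bound1).
[cite: LiebPRL1989, proof of Theorem 1] -/
private theorem exists_abs_energy_le (t : ℝ) {U : ℝ} (hU : 0 ≤ U)
    {X : Matrix (Finset Λ) (Finset Λ) ℂ} (hX : X.IsHermitian) :
    ∃ P : Matrix (Finset Λ) (Finset Λ) ℂ, P.PosSemidef ∧ P * P = X * X ∧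
      hsInner P P = hsInner X X ∧
      (hsInner P (liebOp (hoppingMatrix G t) numberAt (-U) P)).re ≤
        (hsInner X (liebOp (hoppingMatrix G t) numberAt (-U) X)).re := by
  classical
  set V : Matrix (Finset Λ) (Finset Λ) ℂ := (hX.eigenvectorUnitary : Matrix (Finset Λ) (Finset Λ) ℂ)
    with hVdef
  set f : Finset Λ → ℝ := hX.eigenvalues with hf
  have hV : Vᴴ * V = 1 := by
    rw [← star_eq_conjTranspose]
    exact Unitary.coe_star_mul_self hX.eigenvectorUnitary
  have hXeq : X = unitConj V f := by
    conv_lhs => rw [hX.spectral_theorem]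
    rw [Unitary.conjStarAlgAut_apply, star_eq_conjTranspose]
    rfl
  refine ⟨unitConj V |f|, posSemidef_unitConj V fun a => abs_nonneg _, ?_, ?_, ?_⟩
  · rw [hXeq]
    exact unitConj_abs_mul_self V (hV := hV) f
  · rw [hXeq]
    exact hsInner_unitConj_abs_self hV f
  · rw [hXeq, hsInner_liebOp_of_conjTranspose_eq (unitConj_conjTranspose V |f|),
      hsInner_liebOp_of_conjTranspose_eq (unitConj_conjTranspose V f),
      unitConj_abs_mul_self V (hV := hV) f]
    simp only [Complex.add_re, Complex.re_ofReal_mul, Complex.re_sum, add_le_add_iff_left]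
    refine mul_le_mul_of_nonpos_left (Finset.sum_le_sum fun x _ => ?_) (neg_nonpos.2 hU)
    exact re_trace_unitConj_mul_le V f (numberAt_isHermitian x).eq

open scoped MatrixOrder in
/-- Uniqueness of the positive semidefinite square root (Mathlib's `CFC.sqrt_unique`). [folklore] -/
private theorem posSemidef_eq_of_mul_self_eq {B C : Matrix (Finset Λ) (Finset Λ) ℂ}
    (hB : B.PosSemidef) (hC : C.PosSemidef) (h : B * B = C * C) : B = C := by
  have h1 : CFC.sqrt (C * C) = B := CFC.sqrt_unique h hB.nonneg
  have h2 : CFC.sqrt (C * C) = C := CFC.sqrt_unique rfl hC.nonneg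
  exact h1.symm.trans h2

/-- If `X` is off-diagonal for the splitting `ran Q ⊕ ker Q` of an orthogonal projection `Q`
(`Q X + X Q = X`, `Q X Q = 0`), then the positive square root `P` of `X²` commutes with `Q`:
`Γ = 1 - 2Q` is a Hermitian involution with `Γ X Γ = -X`, so `Γ P Γ ≥ 0` squares to `X²` as well
and equals `P`. [folklore] -/
private theorem proj_comm_of_sq_eq {Q X P : Matrix (Finset Λ) (Finset Λ) ℂ} (hQh : Qᴴ = Q)
    (hQQ : Q * Q = Q) (h1 : Q * X + X * Q = X) (h2 : Q * X * Q = 0)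
    (hP : P.PosSemidef) (hPX : P * P = X * X) : Q * P = P * Q := by
  set Γ : Matrix (Finset Λ) (Finset Λ) ℂ := 1 - (2 : ℂ) • Q with hΓ
  have hΓΓ : Γ * Γ = 1 := by
    have : Γ * Γ = 1 - (4 : ℂ) • Q + (4 : ℂ) • (Q * Q) := by
      simp only [hΓ, sub_mul, mul_sub, one_mul, mul_one, Matrix.smul_mul, Matrix.mul_smul]
      module
    rw [this, hQQ]
    module
  have hΓh : Γᴴ = Γ := by
    rw [hΓ, conjTranspose_sub, conjTranspose_one, conjTranspose_smul, hQh]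
    norm_num
  have hΓX : Γ * X * Γ = -X := by
    have : Γ * X * Γ = X - (2 : ℂ) • (Q * X + X * Q) + (4 : ℂ) • (Q * X * Q) := by
      simp only [hΓ, sub_mul, mul_sub, one_mul, mul_one, Matrix.smul_mul, Matrix.mul_smul,
        smul_add]
      module
    rw [this, h1, h2, smul_zero, add_zero]
    module
  have hXX : Γ * (X * X) * Γ = X * X := by
    calc Γ * (X * X) * Γ = (Γ * X * Γ) * (Γ * X * Γ) := by
          simp only [Matrix.mul_assoc]
          rw [← Matrix.mul_assoc Γ Γ, hΓΓ, Matrix.one_mul]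
      _ = X * X := by rw [hΓX, neg_mul_neg]
  have hQpsd : (Γ * P * Γ).PosSemidef := by
    have h := hP.mul_mul_conjTranspose_same Γ
    rwa [hΓh] at h
  have hQQ : Γ * P * Γ * (Γ * P * Γ) = P * P := by
    calc Γ * P * Γ * (Γ * P * Γ) = Γ * (P * P) * Γ := by
          simp only [Matrix.mul_assoc]
          rw [← Matrix.mul_assoc Γ Γ, hΓΓ, Matrix.one_mul]
      _ = P * P := by rw [hPX, hXX]
  have hQ : Γ * P * Γ = P := posSemidef_eq_of_mul_self_eq hQpsd hP hQQ
  have hΓP : Γ * P = P * Γ := by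
    calc Γ * P = Γ * P * (Γ * Γ) := by rw [hΓΓ, Matrix.mul_one]
      _ = Γ * P * Γ * Γ := by simp only [Matrix.mul_assoc]
      _ = P * Γ := by rw [hQ]
  have h3 : P - (2 : ℂ) • (Q * P) = P - (2 : ℂ) • (P * Q) := by
    have h := hΓP
    simp only [hΓ, sub_mul, mul_sub, one_mul, mul_one, Matrix.smul_mul, Matrix.mul_smul] at h
    exact h
  have h4 : (2 : ℂ) • (Q * P) = (2 : ℂ) • (P * Q) := sub_right_injective h3
  exact smul_right_injective _ two_ne_zero h4

/-- **Block structure of `|X|` for the dilation `X = M + Mᴴ`** of a matrix `M` supported on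
`a`-particle rows and `b`-particle columns, `a ≠ b` (Tian's zero-padded `𝒲` and its polar part):
the positive square root `P` of `X² = M Mᴴ + Mᴴ M` is `Π_a P Π_a + Π_b P Π_b`, and both blocks have
Hilbert–Schmidt norm `‖M‖` (`Tr Π_a P² = Tr M Mᴴ`, `Tr Π_b P² = Tr Mᴴ M`; these are Tian's
`⟨Ψ₁|Ψ₁⟩ = ⟨Ψ₂|Ψ₂⟩ = Σ h_l² = ⟨Ψ₀|Ψ₀⟩`). Tian, PRB 58 (1998) 7612, Step 3, eqs. (Matrix), (WF2)
and the normalisation display before (Bound2). [cite: Tian1998ChargeSpinGap, Step 3] -/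
private theorem abs_dilation_decomp {a b : ℕ} (hab : a ≠ b) {M P : Matrix (Finset Λ) (Finset Λ) ℂ}
    (hM : ∀ α β, M α β ≠ 0 → α.card = a ∧ β.card = b) (hP : P.PosSemidef)
    (hPX : P * P = (M + Mᴴ) * (M + Mᴴ)) {Qa Qb : Matrix (Finset Λ) (Finset Λ) ℂ}
    (hQa : Qa = diagonal fun α : Finset Λ => if α.card = a then (1 : ℂ) else 0)
    (hQb : Qb = diagonal fun α : Finset Λ => if α.card = b then (1 : ℂ) else 0) :
    P = Qa * P * Qa + Qb * P * Qb ∧ hsInner (Qa * P * Qa) (Qa * P * Qa) = hsInner M M ∧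
      hsInner (Qb * P * Qb) (Qb * P * Qb) = hsInner M M := by
  subst hQa hQb
  set Qa : Matrix (Finset Λ) (Finset Λ) ℂ :=
    (diagonal fun α : Finset Λ => if α.card = a then (1 : ℂ) else 0) with hQa
  set Qb : Matrix (Finset Λ) (Finset Λ) ℂ :=
    (diagonal fun α : Finset Λ => if α.card = b then (1 : ℂ) else 0) with hQb
  set X := M + Mᴴ with hX
  have hMt := supp_conjTranspose hM
  have hMr : ∀ α β, M α β ≠ 0 → α.card = a := fun α β h => (hM α β h).1
  have hMc : ∀ α β, M α β ≠ 0 → β.card = b := fun α β h => (hM α β h).2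
  have hMtr : ∀ α β, Mᴴ α β ≠ 0 → α.card = b := fun α β h => (hMt α β h).1
  have hMtc : ∀ α β, Mᴴ α β ≠ 0 → β.card = a := fun α β h => (hMt α β h).2
  have haM : Qa * M = M := cardProj_mul_of_row hMr
  have hbM : Qb * M = 0 := cardProj_mul_eq_zero_of_row hab.symm hMr
  have haMt : Qa * Mᴴ = 0 := cardProj_mul_eq_zero_of_row hab hMtr
  have hbMt : Qb * Mᴴ = Mᴴ := cardProj_mul_of_row hMtr
  have hMa : M * Qa = 0 := mul_cardProj_eq_zero_of_col hab hMc
  have hMb : M * Qb = M := mul_cardProj_of_col hMc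
  have hMta : Mᴴ * Qa = Mᴴ := mul_cardProj_of_col hMtc
  have hMtb : Mᴴ * Qb = 0 := mul_cardProj_eq_zero_of_col hab.symm hMtc
  have hPaX : Qa * X = M := by rw [hX, Matrix.mul_add, haM, haMt, add_zero]
  have hXPa : X * Qa = Mᴴ := by rw [hX, Matrix.add_mul, hMa, hMta, zero_add]
  have hPbX : Qb * X = Mᴴ := by rw [hX, Matrix.mul_add, hbM, hbMt, zero_add]
  have hXPb : X * Qb = M := by rw [hX, Matrix.add_mul, hMb, hMtb, add_zero]
  have hPh : Pᴴ = P := hP.1.eq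
  -- `P` commutes with `Π_a` and `Π_b`
  have hQah : Qaᴴ = Qa := cardProj_conjTranspose a
  have hQbh : Qbᴴ = Qb := cardProj_conjTranspose b
  have hQaQa : Qa * Qa = Qa := cardProj_mul_cardProj a
  have hQbQb : Qb * Qb = Qb := cardProj_mul_cardProj b
  have hca : Qa * P = P * Qa :=
    proj_comm_of_sq_eq hQah hQaQa (by rw [hPaX, hXPa]) (by rw [hPaX, hMa]) hP hPX
  have hcb : Qb * P = P * Qb :=
    proj_comm_of_sq_eq hQbh hQbQb (by rw [hPbX, hXPb, add_comm]) (by rw [hPbX, hMtb]) hP hPX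
  -- the remainder `Pz P`, `Pz = 1 - Π_a - Π_b`, vanishes: `Tr (Pz P)(Pz P)ᴴ = Tr Pz X² Pz = 0`
  set Pz : Matrix (Finset Λ) (Finset Λ) ℂ := 1 - Qa - Qb with hPz
  have hPzX : Pz * X = 0 := by
    rw [hPz, Matrix.sub_mul, Matrix.sub_mul, Matrix.one_mul, hPaX, hPbX, hX]
    abel
  have hR : Pz * P = 0 := by
    rw [← hsInner_self_re_eq_zero_iff]
    have : hsInner (Pz * P) (Pz * P) = 0 := by
      rw [hsInner, trace_mul_comm, conjTranspose_mul, hPh,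
        show Pz * P * (P * Pzᴴ) = (Pz * (P * P)) * Pzᴴ by simp only [Matrix.mul_assoc], hPX,
        ← Matrix.mul_assoc, hPzX, Matrix.zero_mul, Matrix.zero_mul, trace_zero]
    rw [this, Complex.zero_re]
  have hdec0 : P = Qa * P + Qb * P := by
    have h : Pz * P = P - Qa * P - Qb * P := by
      rw [hPz, Matrix.sub_mul, Matrix.sub_mul, Matrix.one_mul]
    rw [h] at hR
    have h' : P = Qa * P + Qb * P := by
      rw [← sub_eq_zero]
      rw [← hR]
      abel
    exact h'
  have haPa : Qa * P * Qa = Qa * P := by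
    rw [Matrix.mul_assoc, ← hca, ← Matrix.mul_assoc, hQaQa]
  have hbPb : Qb * P * Qb = Qb * P := by
    rw [Matrix.mul_assoc, ← hcb, ← Matrix.mul_assoc, hQbQb]
  -- norms of the blocks
  have hMM : (M * M).trace = 0 := by
    have h := hsInner_eq_zero_of_row hab.symm hMtr hMr
    rwa [hsInner, conjTranspose_conjTranspose] at h
  have hMtMt : (Mᴴ * Mᴴ).trace = 0 := by
    have h := hsInner_eq_zero_of_row hab hMr hMtr
    rwa [hsInner] at h
  have hnorm : ∀ Q : Matrix (Finset Λ) (Finset Λ) ℂ, Qᴴ = Q → Q * Q = Q →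
      hsInner (Q * P) (Q * P) = (Q * X * X).trace := by
    intro Q hQh hQQ
    rw [hsInner, conjTranspose_mul, hPh, hQh,
      show P * Q * (Q * P) = P * (Q * Q) * P by simp only [Matrix.mul_assoc], hQQ, trace_mul_cycle,
      hPX, trace_mul_comm, Matrix.mul_assoc]
  refine ⟨by rw [haPa, hbPb]; exact hdec0, ?_, ?_⟩
  · rw [haPa, hnorm Qa hQah hQaQa, hPaX, hX, Matrix.mul_add, trace_add, hMM, zero_add, hsInner,
      trace_mul_comm]
  · rw [hbPb, hnorm Qb hQbh hQbQb, hPbX, hX, Matrix.mul_add, trace_add, hMtMt, add_zero, hsInner]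

/-! ### Lieb's coordinates: sectors and energies -/

/-- In Lieb's hole-transformed coordinates a coefficient matrix supported on `a`-particle rows and
`b`-particle (down-hole) columns is a vector of the sector `(N↑, N↓) = (a, |Λ| - b)`.
Lieb, PRL 62 (1989) 1201, proof of Theorem 2; Tian, PRB 58 (1998) 7612, Steps 1 and 4.
[cite: LiebPRL1989, proof of Theorem 2] -/
private theorem isInSector_toFock (A : Finset Λ) {a b : ℕ} {M : Matrix (Finset Λ) (Finset Λ) ℂ}
    (hM : ∀ α β, M α β ≠ 0 → α.card = a ∧ β.card = b) :
    IsInSector a (Fintype.card Λ - b) (LiebTwo.toFock A M) := by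
  intro s hs
  simp only [LiebTwo.toFock]
  by_contra h
  have hM' : M (upPart s) (downPart s)ᶜ ≠ 0 := fun h0 => h (by rw [h0, mul_zero])
  obtain ⟨h1, h2⟩ := hM _ _ hM'
  rw [Finset.card_compl] at h2
  have := Finset.card_le_univ (downPart s)
  exact hs ⟨h1, by omega⟩

/-- Conversely, the coefficient matrix of a vector of the sector `(p, q)` is supported on
`p`-particle rows and `(|Λ| - q)`-particle columns. [cite: LiebPRL1989, proof of Theorem 2] -/
private theorem supp_ofFock (A : Finset Λ) {p q : ℕ} {ψ : Fock (Orb Λ)} (hψ : IsInSector p q ψ) :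
    ∀ α β, LiebTwo.ofFock A ψ α β ≠ 0 → α.card = p ∧ β.card = Fintype.card Λ - q := by
  intro α β h
  simp only [LiebTwo.ofFock] at h
  have hψ' : ψ (pairSet α βᶜ) ≠ 0 := fun h0 => h (by rw [h0, mul_zero])
  have hsec : (upPart (pairSet α βᶜ)).card = p ∧ (downPart (pairSet α βᶜ)).card = q := by
    by_contra hc
    exact hψ' (hψ _ hc)
  rw [upPart_pairSet, downPart_pairSet, Finset.card_compl] at hsec
  have := Finset.card_le_univ β
  omega

/-- The Hubbard energy in Lieb's coordinates: `⟨ψ_M, H ψ_M⟩ = ⟨M, 𝓛₀ M⟩ + U ⟨M, N M⟩`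
(`LiebTwo.hamiltonian_mulVec_toFock` and unitarity of `toFock`). Lieb, PRL 62 (1989) 1201,
eqs. (4)–(5). [cite: LiebPRL1989, eqs. (4)–(5)] -/
private theorem expect_toFock (A : Finset Λ) (hA : ∀ x y : Λ, G.Adj x y → (x ∈ A ↔ y ∉ A))
    (t U : ℝ) (M : Matrix (Finset Λ) (Finset Λ) ℂ) :
    star (LiebTwo.toFock A M) ⬝ᵥ (hamiltonian G t U *ᵥ LiebTwo.toFock A M) =
      hsInner M (liebOp (hoppingMatrix G t) numberAt (-U) M) +
        (U : ℂ) * hsInner M (totalNumberOp * M) := by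
  rw [LiebTwo.hamiltonian_mulVec_toFock G A hA, LiebTwo.star_toFock_dotProduct_toFock,
    LiebTwo.liebOperator, hsInner_add_right, hsInner_smul_right]

/-- On matrices with `a`-particle rows the one-body term is `N M = a M`. [folklore] -/
private theorem totalNumberOp_mul_of_row {a : ℕ} {M : Matrix (Finset Λ) (Finset Λ) ℂ}
    (hM : ∀ α β, M α β ≠ 0 → α.card = a) :
    (totalNumberOp : Matrix (Finset Λ) (Finset Λ) ℂ) * M = (a : ℂ) • M := by
  ext α β
  rw [totalNumberOp_eq_diagonal, diagonal_mul, Matrix.smul_apply, smul_eq_mul]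
  by_cases h : M α β = 0
  · rw [h, mul_zero, mul_zero]
  · rw [hM α β h]

/-- The variational principle in a square sector, in Lieb's coordinates: for `Z` supported on
`c`-particle rows and columns (a vector of the sector `(c, c')`, `c + c' = |Λ|`),
`E(c, c') ‖Z‖² ≤ Re ⟨Z, 𝓛₀ Z⟩ + U c ‖Z‖²`. Tian, PRB 58 (1998) 7612, Step 3 ("by the variational
principle, we obtain (Bound2)"). [cite: Tian1998ChargeSpinGap, Step 3] -/
private theorem sector_bound_toFock (A : Finset Λ) (hA : ∀ x y : Λ, G.Adj x y → (x ∈ A ↔ y ∉ A))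
    (t U : ℝ) {c c' : ℕ} (hcc' : c + c' = Fintype.card Λ) {Z : Matrix (Finset Λ) (Finset Λ) ℂ}
    (hZ : ∀ α β, Z α β ≠ 0 → α.card = c ∧ β.card = c) :
    (hamiltonian G t U).minEnergyOn (szSector (c + c') (((c : ℝ) - c') / 2)) * (hsInner Z Z).re ≤
      (hsInner Z (liebOp (hoppingMatrix G t) numberAt (-U) Z)).re + U * c * (hsInner Z Z).re := by
  have hc : c ≤ Fintype.card Λ := by omega
  have hc' : c' ≤ Fintype.card Λ := by omega
  obtain ⟨-, hbd⟩ := upDownSector_groundState G t U hc hc'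
  have hsec : IsInSector c c' (LiebTwo.toFock A Z) := by
    have h := isInSector_toFock A hZ
    rwa [show Fintype.card Λ - c = c' by omega] at h
  have h := hbd _ hsec
  rw [LiebTwo.star_toFock_dotProduct_toFock] at h
  have hE : expect (hamiltonian G t U) (LiebTwo.toFock A Z) =
      hsInner Z (liebOp (hoppingMatrix G t) numberAt (-U) Z) +
        (U : ℂ) * ((c : ℂ) * hsInner Z Z) := by
    have h2 := expect_toFock G A hA t U Z
    rw [totalNumberOp_mul_of_row (fun α β h => (hZ α β h).1), hsInner_smul_right] at h2
    exact h2
  rw [hE] at h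
  simp only [Complex.add_re, Complex.mul_re, Complex.ofReal_re, Complex.ofReal_im,
    Complex.natCast_re, Complex.natCast_im, zero_mul, sub_zero] at h
  linarith

/-! ### Tian's inequality -/

/-- **Tian's inequality (Bound2), in `S^z` sectors of the repulsive model.** For the Hubbard
model `H = -tΣc†c + UΣn↑n↓` with `U ≥ 0` on a bipartite graph and sectors `(N↑, N↓) = (a, a')`,
`(b, b')`, `(a, b')` with `a + a' = b + b' = |Λ|`, `a ≠ b`,
`E(a, a') + E(b, b') + U (a - b) ≤ 2 E(a, b')`, where `E(p, q)` is the lowest energy of `H` in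
the sector (`minEnergyOn` of `szSector (p + q) ((p - q)/2)`). This is Tian's
`E₀(Ñ + 2) + E₀(Ñ) ≤ 2 E₀(Ñ + 1)` for the attractive model `H̃` (Step 3: Lieb's two-species
coordinates, the coefficient matrix of the `(a, b')` ground state is rectangular, spin-reflection
positivity applied to its square completion, Cauchy–Schwarz, and the variational principle in the
two square sectors), transported to `H` by the partial particle–hole transformation (Steps 1, 4);
the term `U (a - b)` is the one-body term `U N_↑` of that transformation in the convention
`U n↑ n↓` (Tian writes `U (n↑ - ½)(n↓ - ½)`). Here the square completion is the Hermitian dilation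
`M + Mᴴ` rather than Tian's zero-padded `𝒲 = (O M; O O)` with its polar factorisation.
Tian, PRB 58 (1998) 7612, Steps 1–4, eq. (Bound2). [cite: Tian1998ChargeSpinGap, eq. (Bound2)] -/
theorem hubbard_minEnergyOn_sector_reflection_ineq (A : Finset Λ)
    (hA : ∀ x y : Λ, G.Adj x y → (x ∈ A ↔ y ∉ A)) (t : ℝ) {U : ℝ} (hU : 0 ≤ U)
    {a a' b b' : ℕ} (hab : a ≠ b) (haa' : a + a' = Fintype.card Λ)
    (hbb' : b + b' = Fintype.card Λ) :
    (hamiltonian G t U).minEnergyOn (szSector (a + a') (((a : ℝ) - a') / 2)) +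
        (hamiltonian G t U).minEnergyOn (szSector (b + b') (((b : ℝ) - b') / 2)) +
        U * ((a : ℝ) - b) ≤
      2 * (hamiltonian G t U).minEnergyOn (szSector (a + b') (((a : ℝ) - b') / 2)) := by
  classical
  have ha : a ≤ Fintype.card Λ := by omega
  have hb' : b' ≤ Fintype.card Λ := by omega
  -- the ground state of the rectangular sector `(a, b')` and its coefficient matrix `M`
  obtain ⟨⟨χ, hχsec, hχ0, hHχ⟩, -⟩ := upDownSector_groundState G t U ha hb'
  set eAB := (hamiltonian G t U).minEnergyOn (szSector (a + b') (((a : ℝ) - b') / 2)) with heAB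
  set M : Matrix (Finset Λ) (Finset Λ) ℂ := LiebTwo.ofFock A χ with hMdef
  have hMsupp : ∀ α β, M α β ≠ 0 → α.card = a ∧ β.card = b := by
    intro α β h
    have h' := supp_ofFock A hχsec α β h
    exact ⟨h'.1, by omega⟩
  have hMr : ∀ α β, M α β ≠ 0 → α.card = a := fun α β h => (hMsupp α β h).1
  have hMtr : ∀ α β, Mᴴ α β ≠ 0 → α.card = b := fun α β h => (supp_conjTranspose hMsupp α β h).1
  have hχM : LiebTwo.toFock A M = χ := LiebTwo.toFock_ofFock A χ
  have hM0 : M ≠ 0 := fun h => hχ0 (by rw [← hχM, h, LiebTwo.toFock_zero])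
  have hm : 0 < (hsInner M M).re :=
    lt_of_le_of_ne (hsInner_self_re_nonneg M) fun h =>
      hM0 ((hsInner_self_re_eq_zero_iff M).1 h.symm)
  -- `Re ⟨M, 𝓛₀ M⟩ = (E(a, b') - U a) ‖M‖²`
  have hEM : (hsInner M (liebOp (hoppingMatrix G t) numberAt (-U) M)).re =
      eAB * (hsInner M M).re - U * a * (hsInner M M).re := by
    have h1 := expect_toFock G A hA t U M
    rw [hχM, hHχ, dotProduct_smul, smul_eq_mul, ← hχM, LiebTwo.star_toFock_dotProduct_toFock,
      totalNumberOp_mul_of_row hMr, hsInner_smul_right] at h1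
    have h2 := congrArg Complex.re h1
    simp only [Complex.add_re, Complex.mul_re, Complex.ofReal_re, Complex.ofReal_im,
      Complex.natCast_re, Complex.natCast_im, zero_mul, sub_zero] at h2
    linarith
  -- the dilation `X = M + Mᴴ`, Lieb's `P = |X|` and its blocks `Π_a P Π_a`, `Π_b P Π_b`
  have hXh : (M + Mᴴ).IsHermitian := by
    rw [IsHermitian, conjTranspose_add, conjTranspose_conjTranspose, add_comm]
  obtain ⟨P, hPpsd, hPP, -, hPle⟩ := exists_abs_energy_le G t hU hXh
  obtain ⟨hPdec, hPa, hPb⟩ := abs_dilation_decomp hab hMsupp hPpsd hPP rfl rfl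
  set Qa : Matrix (Finset Λ) (Finset Λ) ℂ :=
    (diagonal fun α : Finset Λ => if α.card = a then (1 : ℂ) else 0) with hQa
  set Qb : Matrix (Finset Λ) (Finset Λ) ℂ :=
    (diagonal fun α : Finset Λ => if α.card = b then (1 : ℂ) else 0) with hQb
  have hPasupp : ∀ α β : Finset Λ, (Qa * P * Qa) α β ≠ 0 → α.card = a ∧ β.card = a :=
    supp_cardProj_mul_mul_cardProj a a P
  have hPbsupp : ∀ α β : Finset Λ, (Qb * P * Qb) α β ≠ 0 → α.card = b ∧ β.card = b :=
    supp_cardProj_mul_mul_cardProj b b P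
  -- (1), (2): the variational principle in the square sectors `(a, a')`, `(b, b')`
  have h1 := sector_bound_toFock G A hA t U haa' hPasupp
  have h2 := sector_bound_toFock G A hA t U hbb' hPbsupp
  rw [hPa] at h1
  rw [hPb] at h2
  -- (3): `E(P) = E(Π_a P Π_a) + E(Π_b P Π_b)` (the blocks have rows of different grades)
  have h3 : hsInner P (liebOp (hoppingMatrix G t) numberAt (-U) P) =
      hsInner (Qa * P * Qa)
          (liebOp (hoppingMatrix G t) numberAt (-U) (Qa * P * Qa)) +
        hsInner (Qb * P * Qb)
          (liebOp (hoppingMatrix G t) numberAt (-U) (Qb * P * Qb)) := by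
    have hx1 : hsInner (Qa * P * Qa)
        (liebOp (hoppingMatrix G t) numberAt (-U) (Qb * P * Qb)) = 0 :=
      hsInner_eq_zero_of_row hab (fun α β h => (hPasupp α β h).1)
        (row_liebOp G t U fun α β h => (hPbsupp α β h).1)
    have hx2 : hsInner (Qb * P * Qb)
        (liebOp (hoppingMatrix G t) numberAt (-U) (Qa * P * Qa)) = 0 :=
      hsInner_eq_zero_of_row hab.symm (fun α β h => (hPbsupp α β h).1)
        (row_liebOp G t U fun α β h => (hPasupp α β h).1)
    conv_lhs => rw [hPdec]
    rw [liebOp_add, hsInner_add_left, hsInner_add_right, hsInner_add_right, hx1, hx2, add_zero,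
      zero_add]
  -- (5): `E(X) = E(M) + E(Mᴴ) = 2 E(M)`
  have h5 : hsInner (M + Mᴴ) (liebOp (hoppingMatrix G t) numberAt (-U) (M + Mᴴ)) =
      hsInner M (liebOp (hoppingMatrix G t) numberAt (-U) M) +
        hsInner M (liebOp (hoppingMatrix G t) numberAt (-U) M) := by
    have hx1 : hsInner M (liebOp (hoppingMatrix G t) numberAt (-U) Mᴴ) = 0 :=
      hsInner_eq_zero_of_row hab hMr (row_liebOp G t U hMtr)
    have hx2 : hsInner Mᴴ (liebOp (hoppingMatrix G t) numberAt (-U) M) = 0 :=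
      hsInner_eq_zero_of_row hab.symm hMtr (row_liebOp G t U hMr)
    rw [liebOp_add, hsInner_add_left, hsInner_add_right, hsInner_add_right, hx1, hx2, add_zero,
      zero_add, hsInner_liebOp_conjTranspose_self]
  -- (4): `E(P) ≤ E(X)`; combine and divide by `‖M‖² > 0`
  have h4 := hPle
  rw [h3, h5, Complex.add_re, Complex.add_re] at h4
  have key : ((hamiltonian G t U).minEnergyOn (szSector (a + a') (((a : ℝ) - a') / 2)) +
        (hamiltonian G t U).minEnergyOn (szSector (b + b') (((b : ℝ) - b') / 2)) +
        U * ((a : ℝ) - b)) * (hsInner M M).re ≤ (2 * eAB) * (hsInner M M).re := by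
    linarith
  exact le_of_mul_le_mul_right key hm

/-! ### Half filling: the charge gap dominates the spin gap -/

/-- **Tian's (Bound3) at `N + 1`, convention `U n↑ n↓`.** On a bipartite graph with `|Λ| = 2n`,
`n ≥ 1`, `U ≥ 0`: `E(2n, S^z = 1) + E₀(2n) + U ≤ 2 E₀(2n + 1)` — the case
`(a, b) = (n + 1, n)` of `hubbard_minEnergyOn_sector_reflection_ineq`, with
`E₀(2n) = E(2n, S^z = 0)` and `E₀(2n + 1) = E(2n + 1, S^z = ½)`
(`groundEnergyAt_eq_minEnergyOn_szSector(_odd)`). In Tian's symmetric convention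
`U(n↑ - ½)(n↓ - ½)` the `+ U` is absent. Tian, PRB 58 (1998) 7612, eq. (Bound3).
[cite: Tian1998ChargeSpinGap, eq. (Bound3)] -/
theorem hubbard_halfFilled_szOne_add_ground_add_U_le (A : Finset Λ)
    (hA : ∀ x y : Λ, G.Adj x y → (x ∈ A ↔ y ∉ A)) {n : ℕ} (hn : 1 ≤ n)
    (hΛ : Fintype.card Λ = 2 * n) (t : ℝ) {U : ℝ} (hU : 0 ≤ U) :
    (hamiltonian G t U).minEnergyOn (szSector (2 * n) 1) + groundEnergyAt G t U (2 * n) + U ≤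
      2 * groundEnergyAt G t U (2 * n + 1) := by
  obtain ⟨k, rfl⟩ : ∃ k, n = k + 1 := ⟨n - 1, by omega⟩
  have h := hubbard_minEnergyOn_sector_reflection_ineq G A hA t hU (a := k + 2) (a' := k)
    (b := k + 1) (b' := k + 1) (by omega) (by omega) (by omega)
  have e1 : k + 2 + k = 2 * (k + 1) := by ring
  have e2 : (((k + 2 : ℕ) : ℝ) - (k : ℕ)) / 2 = 1 := by push_cast; ring
  have e3 : k + 1 + (k + 1) = 2 * (k + 1) := by ring
  have e4 : (((k + 1 : ℕ) : ℝ) - (k + 1 : ℕ)) / 2 = 0 := by push_cast; ring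
  have e5 : k + 2 + (k + 1) = 2 * (k + 1) + 1 := by ring
  have e6 : (((k + 2 : ℕ) : ℝ) - (k + 1 : ℕ)) / 2 = 1 / 2 := by push_cast; ring
  have e7 : U * (((k + 2 : ℕ) : ℝ) - (k + 1 : ℕ)) = U := by push_cast; ring
  rw [e1, e2, e3, e4, e5, e6, e7, ← groundEnergyAt_eq_minEnergyOn_szSector G t U (by omega),
    ← groundEnergyAt_eq_minEnergyOn_szSector_odd G t U (by omega)] at h
  exact h

/-- **Tian's (Bound3) at `N - 1`, convention `U n↑ n↓`.** On a bipartite graph with `|Λ| = 2n`,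
`n ≥ 1`, `U ≥ 0`: `E(2n, S^z = 1) + E₀(2n) - U ≤ 2 E₀(2n - 1)` — the case `(a, b) = (n, n + 1)`
of `hubbard_minEnergyOn_sector_reflection_ineq`. Tian, PRB 58 (1998) 7612, eq. (Bound3) (with
the hole side of the particle–hole symmetric statement).
[cite: Tian1998ChargeSpinGap, eq. (Bound3)] -/
theorem hubbard_halfFilled_szOne_add_ground_sub_U_le (A : Finset Λ)
    (hA : ∀ x y : Λ, G.Adj x y → (x ∈ A ↔ y ∉ A)) {n : ℕ} (hn : 1 ≤ n)
    (hΛ : Fintype.card Λ = 2 * n) (t : ℝ) {U : ℝ} (hU : 0 ≤ U) :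
    (hamiltonian G t U).minEnergyOn (szSector (2 * n) 1) + groundEnergyAt G t U (2 * n) - U ≤
      2 * groundEnergyAt G t U (2 * n - 1) := by
  obtain ⟨k, rfl⟩ : ∃ k, n = k + 1 := ⟨n - 1, by omega⟩
  have h := hubbard_minEnergyOn_sector_reflection_ineq G A hA t hU (a := k + 1) (a' := k + 1)
    (b := k + 2) (b' := k) (by omega) (by omega) (by omega)
  have e1 : k + 2 + k = 2 * (k + 1) := by ring
  have e2 : (((k + 2 : ℕ) : ℝ) - (k : ℕ)) / 2 = 1 := by push_cast; ring
  have e3 : k + 1 + (k + 1) = 2 * (k + 1) := by ring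
  have e4 : (((k + 1 : ℕ) : ℝ) - (k + 1 : ℕ)) / 2 = 0 := by push_cast; ring
  have e5 : k + 1 + k = 2 * k + 1 := by ring
  have e6 : (((k + 1 : ℕ) : ℝ) - (k : ℕ)) / 2 = 1 / 2 := by push_cast; ring
  have e7 : U * (((k + 1 : ℕ) : ℝ) - (k + 2 : ℕ)) = -U := by push_cast; ring
  rw [e1, e2, e3, e4, e5, e6, e7, ← groundEnergyAt_eq_minEnergyOn_szSector G t U (by omega),
    ← groundEnergyAt_eq_minEnergyOn_szSector_odd G t U (by omega)] at h
  rw [show 2 * (k + 1) - 1 = 2 * k + 1 by omega]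
  linarith

/-- **Tian's theorem (Hubbard model): the charged gap dominates the spin gap at half filling.**
For the Hubbard model `H = -t Σ_{⟨xy⟩σ} c†_{xσ} c_{yσ} + U Σ_x n_{x↑} n_{x↓}` with `U ≥ 0` on a
finite bipartite graph with colour classes of equal size `|A| = |B| ≥ 1`, at half filling
`N = |Λ|`: the lowest energy with `S^z = 1` exceeds the ground-state energy by at most the charge
gap, `E(|Λ|, S^z = 1) - E₀(|Λ|) ≤ Δ_c(|Λ|) = E₀(|Λ|+1) + E₀(|Λ|-1) - 2E₀(|Λ|)` — the mean of
`hubbard_halfFilled_szOne_add_ground_add_U_le` and `…_sub_U_le` (so no particle–hole symmetry and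
no chemical-potential bookkeeping is needed, and the statement is the same in the conventions
`U n↑n↓` and `U(n↑-½)(n↓-½)`). Under Lieb's hypotheses (`G` connected, `t ≠ 0`, `U > 0`) the
left side is Tian's spin excitation gap `E(N, S = 1) - E(N, S = 0)` (the ground state is the
unique singlet, `groundEnergyAt_lt_minEnergyOn_szSector_one`; the `S^z = 1` minimiser has `S = 1`
by Tian's Step 4); as printed here only bipartiteness, `|A| = |B|` and `U ≥ 0` are used, and the
strictness of Tian's Remark 4 is not asserted. Tian, PRB 58 (1998) 7612, Theorem, inequality
(Inequality) `Δ_c ≥ Δ_s` and eq. (Bound4). [cite: Tian1998ChargeSpinGap, Theorem] -/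
theorem minEnergyOn_szSector_one_sub_groundEnergyAt_le_chargeGap (A : Finset Λ)
    (hA : ∀ x y : Λ, G.Adj x y → (x ∈ A ↔ y ∉ A)) (hcard : Aᶜ.card = A.card) (hA0 : A.Nonempty)
    (t : ℝ) {U : ℝ} (hU : 0 ≤ U) :
    (hamiltonian G t U).minEnergyOn (szSector (Fintype.card Λ) 1) -
        groundEnergyAt G t U (Fintype.card Λ) ≤
      chargeGap G t U (Fintype.card Λ) := by
  have hΛ : Fintype.card Λ = 2 * A.card := by
    rw [← Finset.card_add_card_compl A, hcard, two_mul]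
  obtain ⟨k, hk⟩ : ∃ k, A.card = k + 1 := Nat.exists_eq_add_one.2 hA0.card_pos
  rw [hk] at hΛ
  have h1 := hubbard_halfFilled_szOne_add_ground_add_U_le G A hA (n := k + 1) (by omega) hΛ t hU
  have h2 := hubbard_halfFilled_szOne_add_ground_sub_U_le G A hA (n := k + 1) (by omega) hΛ t hU
  rw [chargeGap, hΛ]
  linarith

end ChargeGapSpinGap

end Literature.MathematicalPhysics.QuantumLattice
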